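import Summits.AnomalousDissipation.AnomalousDissipation.Theorems.SawtoothPulseCascadeK1LocalisedCascadePhaseStepOsc
import Summits.AnomalousDissipation.AnomalousDissipation.Theorems.SawtoothPulseCascadeK1LocalisedCascadeShellChainOsc
import Summits.AnomalousDissipation.AnomalousDissipation.Theorems.SawtoothPulseCascadeK1LocalisedCascadeOscJunkNumeric

/-!
# K1loc — THE FAT OSCILLATORY PHASE j = 6, CERTIFIED (K_6 = 312500000 → K_7 = 7812500000)

Prover lane on the crux `K1LocalisedCascade` (stmt-AnomalousDissipation-19491), route `SawtoothPulseCascade`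
(S-B/S-C assembly seat; the LEDGER ASSEMBLY, numeric layer, Osc grade — one of the certified fat phases `j ≥ 4` between the CT
phases `2, 3` (ad-k1loc-p3) and the thin tail).  `…PhaseStepOsc.resolved_step_osc` at `j = 6`, `K = K_6 = 312500000 = 800·25^4`
(schedule of record, arbiter A23-11/13), rounding target `ε = 2⁻¹⁷`, shell cap from `…ShellChainOsc.sqrt_shell_le_far_add_sum_osc` at
`Y = 3K_6 + 1`, `j₁ = 3`, `ε = 2⁻²⁰`, every closed form bounded by the rational certificates of `…OscJunkNumeric` (`δ₀ ≤ δ* = 2^-100`;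
certificates generated by the seat's `kit/certs.py`): `√J_T ≤ 0.0097`, `√J_S ≤ 0.0045`, `√J_C ≤ 0.0029`, `√J_O ≤ 0.002`, cap `𝔞_6 ≤ 0.0143`:
  **`E_7 ≤ E_6 + (0.000934 + 0.0194·o)`**, `E_j = S_j(K_j) + O_j(K_j)` (strip + off-cone class `(1,4)`), for any `o ≥ √O_6(K_6)`, `o ≥ 0`,
and the next off-cone amplitude **`√O_7(K_7) ≤ 0.0193`**.
No definitions; no statement about the crux. [cite: Grafakos2014, Prop. 3.1.2 (5), Prop. 3.2.7 (3), §3.1.3] [problem: turb]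
-/

-- `Summit.<Summit>.<Problem>`: single-conjunct summit, the duplicate namespace segment is deliberate.
set_option linter.dupNamespace false

noncomputable section

namespace Summit.AnomalousDissipation.AnomalousDissipation.Theorems.SawtoothPulseCascade.K1Window

open MeasureTheory Set Filter Topology UnitAddTorus Function Complex Metric
open scoped Real ENNReal
open Literature.Analysis Literature.Analysis.FunctionSpaces Literature.Analysis.FunctionSpaces.Torus Literature.Analysis.FluidPDE
open Literature.Analysis.FluidPDE.ShearStage
open Literature.Analysis.FluidPDE.SawtoothCascade Literature.Analysis.FluidPDE.SawtoothCascade.CascadeParams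
open Summit.AnomalousDissipation.AnomalousDissipation.Theorems.SawtoothPulseCascade.K1Start
open Summit.AnomalousDissipation.AnomalousDissipation.Theorems.SawtoothPulseCascade.K1Flat
open Summit.AnomalousDissipation.AnomalousDissipation.Theorems.SawtoothPulseCascade.K1Ledger.From

section Cascade

variable (P : CascadeParams)

set_option maxHeartbeats 400000 in
/-- **THE FAT OSCILLATORY PHASE `j = 6`, CERTIFIED** (see the file header): along `K_6 = 312500000 → K_7 = 7812500000`,
`S_7 + O_7 ≤ S_6 + O_6 + (0.000934 + 0.0194·o)` for every `o ≥ √O_6(K_6)`, `o ≥ 0`, and `√O_7(K_7) ≤ 0.0193`.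
[cite: Grafakos2014, Prop. 3.1.2 (5), Prop. 3.2.7 (3), §3.1.3] -/
theorem resolved_step_osc_phase6_sharp (hγ : P.γ = 8) (hδ₀ : 0 < P.δ₀) (hδ₀' : P.δ₀ ≤ (2 : ℝ)⁻¹ ^ 100) (hd : P.d = 2) (hN₀ : P.N₀ = 1)
    (hρN : P.ρN = 2) (a b : ℕ → UnitAddTorus (Fin 2) → ℝ) (has : ∀ j, IsSmooth (a j)) (h0 : a 0 = datum)
    (hb : ∀ j, b j = a j ∘ shearMap 0 1 (amp ⟨P.U j, P.U_periodic j, P.contDiff_U (P.δ_pos hδ₀ (by rw [hd]; norm_num) j)⟩ P.γ))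
    (hab : ∀ j, a (j + 1) = b j ∘ shearMap 1 0 (amp ⟨P.U j, P.U_periodic j, P.contDiff_U (P.δ_pos hδ₀ (by rw [hd]; norm_num) j)⟩ P.γ))
    {o : ℝ} (ho0 : 0 ≤ o)
    (ho : Real.sqrt (∑' k : Fin 2 → ℤ, (if ((312500000 : ℕ) : ℤ) ≤ |k 0| ∧ ((1 : ℕ) : ℤ) * |k 0| ≤ ((4 : ℕ) : ℤ) * |k 1| then (1 : ℝ) else 0) *
        ‖mFourierCoeff (fun x => (a 6 x : ℂ)) k‖ ^ 2) ≤ o) :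
    ∑' k : Fin 2 → ℤ, (if |k 0| < ((7812500000 : ℕ) : ℤ) then (1 : ℝ) else 0) * ‖mFourierCoeff (fun x => (a 7 x : ℂ)) k‖ ^ 2 +
        ∑' k : Fin 2 → ℤ, (if ((7812500000 : ℕ) : ℤ) ≤ |k 0| ∧ ((1 : ℕ) : ℤ) * |k 0| ≤ ((4 : ℕ) : ℤ) * |k 1| then (1 : ℝ) else 0) *
          ‖mFourierCoeff (fun x => (a 7 x : ℂ)) k‖ ^ 2 ≤
      ∑' k : Fin 2 → ℤ, (if |k 0| < ((312500000 : ℕ) : ℤ) then (1 : ℝ) else 0) * ‖mFourierCoeff (fun x => (a 6 x : ℂ)) k‖ ^ 2 +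
        ∑' k : Fin 2 → ℤ, (if ((312500000 : ℕ) : ℤ) ≤ |k 0| ∧ ((1 : ℕ) : ℤ) * |k 0| ≤ ((4 : ℕ) : ℤ) * |k 1| then (1 : ℝ) else 0) *
          ‖mFourierCoeff (fun x => (a 6 x : ℂ)) k‖ ^ 2 + (0.000934 + 0.0194 * o) ∧
    Real.sqrt (∑' k : Fin 2 → ℤ, (if ((7812500000 : ℕ) : ℤ) ≤ |k 0| ∧ ((1 : ℕ) : ℤ) * |k 0| ≤ ((4 : ℕ) : ℤ) * |k 1| then (1 : ℝ) else 0) *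
        ‖mFourierCoeff (fun x => (a 7 x : ℂ)) k‖ ^ 2) ≤ 0.0193 := by
  have hδ₀0 : 0 ≤ P.δ₀ := hδ₀.le
  have hε : (0 : ℝ) < (2 : ℝ)⁻¹ ^ 17 := by positivity
  have hεA : (0 : ℝ) < (2 : ℝ)⁻¹ ^ 20 := by positivity
  have hI0 : ∀ (q : (Fin 2 → ℤ) → Prop) [DecidablePred q] (v : UnitAddTorus (Fin 2) → ℝ),
      0 ≤ ∑' k : Fin 2 → ℤ, (if q k then (1 : ℝ) else 0) * ‖mFourierCoeff (fun x => (v x : ℂ)) k‖ ^ 2 :=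
    fun q _ v => tsum_nonneg fun k => mul_nonneg (by split_ifs <;> norm_num) (sq_nonneg _)
  -- §1 the four junk amplitudes of the phase (certificates of `kit/certs.py`)
  obtain ⟨hwT, hZT⟩ := sqrt_juncT_le P hd hδ₀0 hδ₀' (K := 312500000) (by norm_num) hε (3 + 3) (m := 102) (M₀ := 11.9)
    (s := (2 : ℝ)⁻¹ ^ 65) (e₀ := ((2 : ℝ)⁻¹ ^ 17) ^ 2) (w := 0.0097)
    (by norm_num) (by norm_num) (by norm_num) (by positivity) (by norm_num) le_rfl (by norm_num) (by norm_num)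
  obtain ⟨hwS, hZS⟩ := sqrt_juncS_le P hd hδ₀0 hδ₀' (K := 312500000) (by norm_num) hε (3 + 3) (m := 112) (M₀ := 12.47)
    (s := (2 : ℝ)⁻¹ ^ 66) (e₀ := ((2 : ℝ)⁻¹ ^ 17) ^ 2) (w := 0.0045)
    (by norm_num) (by norm_num) (by norm_num) (by positivity) (by norm_num) le_rfl (by norm_num) (by norm_num)
  obtain ⟨hwC, hZC⟩ := sqrt_juncC_le P hd hδ₀0 hδ₀' 312500000 hε (3 + 3) (m := 110) (M₀ := 12.35)
    (s := (2 : ℝ)⁻¹ ^ 66) (e₀ := ((2 : ℝ)⁻¹ ^ 17) ^ 2) (w := 0.0029)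
    (by norm_num) (by norm_num) (by norm_num) (by positivity) (by norm_num) le_rfl (by norm_num) (by norm_num)
  obtain ⟨hwO, hZO⟩ := sqrt_juncO_le P hd hδ₀0 hδ₀' (K := 312500000) (by norm_num) hε (3 + 3) (m := 111) (M₀ := 12.41)
    (s := (2 : ℝ)⁻¹ ^ 66) (e₀ := ((2 : ℝ)⁻¹ ^ 17) ^ 2) (w := 0.002)
    (by norm_num) (by norm_num) (by norm_num) (by positivity) (by norm_num) le_rfl (by norm_num) (by norm_num)
  -- §2 the far terms of the phase
  have hfT := far_sq_le P hγ (t := 3 + 3) (X := 312500000 * 2 ^ (7 * (3 + 3) + 12)) (ψ := (2 : ℝ)⁻¹ ^ 44) (by positivity) (by norm_num)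
  have hfS := far_sq_le P hγ (t := 3 + 3 + 1) (X := (5 * 312500000) * 2 ^ (7 * (3 + 3) + 19)) (ψ := (2 : ℝ)⁻¹ ^ 47)
    (by positivity) (by norm_num)
  have hfO := far_sq_le P hγ (t := 3 + 3 + 1) (X := (6 * 312500000) * 2 ^ (7 * (3 + 3) + 19)) (ψ := (2 : ℝ)⁻¹ ^ 47)
    (by positivity) (by norm_num)
  have hfC := sqrt_far_sq_le P hγ (t := 3 + 3) (X := (3 * 312500000 + 1) * 2 ^ (7 * (3 + 3) + 19)) (ψ := (2 : ℝ)⁻¹ ^ 52)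
    (by positivity) (by norm_num)
  have hfO' := sqrt_far_sq_le P hγ (t := 3 + 3 + 1) (X := (6 * 312500000) * 2 ^ (7 * (3 + 3) + 19)) (ψ := (2 : ℝ)⁻¹ ^ 47)
    (by positivity) (by norm_num)
  -- §3 the shell cap at `Y = 3K + 1` from `j₁ = 3`
  have hzA := shell_zone_cond P hd hδ₀0 hδ₀' (ε := (2 : ℝ)⁻¹ ^ 20) (A := 7) (Pw := 2 ^ 20) (X := (((3 * 312500000 + 1) / 2 : ℕ) : ℝ))
    hεA (by norm_num) (by norm_num) (by norm_num) (m := 77) (M₀ := 10.34) (by norm_num) (by norm_num) (by norm_num) (by norm_num)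
  have hzB := shell_zone_cond P hd hδ₀0 hδ₀' (ε := (2 : ℝ)⁻¹ ^ 20) (A := 13 / 3) (Pw := 2 ^ 20) (X := ((3 * 312500000 + 1 : ℕ) : ℝ))
    hεA (by norm_num) (by norm_num) (by norm_num) (m := 77) (M₀ := 10.34) (by norm_num) (by norm_num) (by norm_num) (by norm_num)
  have hcap := sqrt_shell_le_far_add_sum_osc P hγ hδ₀ hd hN₀ hρN a b has h0 hb hab (Y := 3 * 312500000 + 1) (by norm_num) hεA
    hzA hzB 3 3
  rw [Finset.sum_range_succ, Finset.sum_range_succ, Finset.sum_range_succ, Finset.sum_range_zero, zero_add] at hcap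
  have hhead := far_head_le P hγ (j₁ := 3) (Y := 3 * 312500000 + 1) (φ := (2 : ℝ)⁻¹ ^ 10) (by norm_num) (by norm_num)
  obtain ⟨hwA3, -⟩ := sqrt_juncA_le P hd hδ₀0 hδ₀' (Y := 3 * 312500000 + 1) (by norm_num) hεA (3 + 0) (m := 95) (M₀ := 11.48)
    (s := (2 : ℝ)⁻¹ ^ 64) (e₀ := ((2 : ℝ)⁻¹ ^ 20) ^ 2) (w := 0.0023)
    (by norm_num) (by norm_num) (by norm_num) (by positivity) (by norm_num) le_rfl (by norm_num) (by norm_num)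
  obtain ⟨hwB3, -⟩ := sqrt_juncB_le P hd hδ₀0 hδ₀' (Y := 3 * 312500000 + 1) (by norm_num) hεA (3 + 0) (m := 95) (M₀ := 11.48)
    (s := (2 : ℝ)⁻¹ ^ 65) (e₀ := ((2 : ℝ)⁻¹ ^ 20) ^ 2) (w := 0.0007)
    (by norm_num) (by norm_num) (by norm_num) (by positivity) (by norm_num) le_rfl (by norm_num) (by norm_num)
  have hfA3 := sqrt_far_sq_le P hγ (t := 3 + 0 + 1) (X := ((3 * 312500000 + 1) / 2) * 2 ^ (7 * (3 + 0) + 20)) (ψ := (2 : ℝ)⁻¹ ^ 44)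
    (by positivity) (by norm_num)
  have hfB3 := sqrt_far_sq_le P hγ (t := 3 + 0) (X := (3 * 312500000 + 1) * 2 ^ (7 * (3 + 0) + 20)) (ψ := (2 : ℝ)⁻¹ ^ 51)
    (by positivity) (by norm_num)
  have hω3 := omega_osc_le hwA3 hwB3 hfA3 hfB3
  obtain ⟨hwA4, -⟩ := sqrt_juncA_le P hd hδ₀0 hδ₀' (Y := 3 * 312500000 + 1) (by norm_num) hεA (3 + 1) (m := 101) (M₀ := 11.84)
    (s := (2 : ℝ)⁻¹ ^ 64) (e₀ := ((2 : ℝ)⁻¹ ^ 20) ^ 2) (w := 0.0033)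
    (by norm_num) (by norm_num) (by norm_num) (by positivity) (by norm_num) le_rfl (by norm_num) (by norm_num)
  obtain ⟨hwB4, -⟩ := sqrt_juncB_le P hd hδ₀0 hδ₀' (Y := 3 * 312500000 + 1) (by norm_num) hεA (3 + 1) (m := 101) (M₀ := 11.84)
    (s := (2 : ℝ)⁻¹ ^ 65) (e₀ := ((2 : ℝ)⁻¹ ^ 20) ^ 2) (w := 0.001)
    (by norm_num) (by norm_num) (by norm_num) (by positivity) (by norm_num) le_rfl (by norm_num) (by norm_num)
  have hfA4 := sqrt_far_sq_le P hγ (t := 3 + 1 + 1) (X := ((3 * 312500000 + 1) / 2) * 2 ^ (7 * (3 + 1) + 20)) (ψ := (2 : ℝ)⁻¹ ^ 45)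
    (by positivity) (by norm_num)
  have hfB4 := sqrt_far_sq_le P hγ (t := 3 + 1) (X := (3 * 312500000 + 1) * 2 ^ (7 * (3 + 1) + 20)) (ψ := (2 : ℝ)⁻¹ ^ 52)
    (by positivity) (by norm_num)
  have hω4 := omega_osc_le hwA4 hwB4 hfA4 hfB4
  obtain ⟨hwA5, -⟩ := sqrt_juncA_le P hd hδ₀0 hδ₀' (Y := 3 * 312500000 + 1) (by norm_num) hεA (3 + 2) (m := 107) (M₀ := 12.18)
    (s := (2 : ℝ)⁻¹ ^ 65) (e₀ := ((2 : ℝ)⁻¹ ^ 20) ^ 2) (w := 0.0046)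
    (by norm_num) (by norm_num) (by norm_num) (by positivity) (by norm_num) le_rfl (by norm_num) (by norm_num)
  obtain ⟨hwB5, -⟩ := sqrt_juncB_le P hd hδ₀0 hδ₀' (Y := 3 * 312500000 + 1) (by norm_num) hεA (3 + 2) (m := 107) (M₀ := 12.18)
    (s := (2 : ℝ)⁻¹ ^ 66) (e₀ := ((2 : ℝ)⁻¹ ^ 20) ^ 2) (w := 0.0014)
    (by norm_num) (by norm_num) (by norm_num) (by positivity) (by norm_num) le_rfl (by norm_num) (by norm_num)
  have hfA5 := sqrt_far_sq_le P hγ (t := 3 + 2 + 1) (X := ((3 * 312500000 + 1) / 2) * 2 ^ (7 * (3 + 2) + 20)) (ψ := (2 : ℝ)⁻¹ ^ 45)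
    (by positivity) (by norm_num)
  have hfB5 := sqrt_far_sq_le P hγ (t := 3 + 2) (X := (3 * 312500000 + 1) * 2 ^ (7 * (3 + 2) + 20)) (ψ := (2 : ℝ)⁻¹ ^ 53)
    (by positivity) (by norm_num)
  have hω5 := omega_osc_le hwA5 hwB5 hfA5 hfB5
  have hαle : Real.sqrt (∑' k : Fin 2 → ℤ, (if ((3 * 312500000 + 1 : ℕ) : ℤ) ≤ |k 0| ∧ ((1 : ℕ) : ℤ) * |k 0| ≤ ((2 : ℕ) : ℤ) * |k 1|
        then (1 : ℝ) else 0) * ‖mFourierCoeff (fun x => (a (3 + 3) x : ℂ)) k‖ ^ 2) ≤ 0.0143 := by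
    have hnum : (2 : ℝ)⁻¹ ^ 10 +
        (0.0023 + 0.0007 + (2 : ℝ)⁻¹ ^ 44 + (2 : ℝ)⁻¹ ^ 51) +
        (0.0033 + 0.001 + (2 : ℝ)⁻¹ ^ 45 + (2 : ℝ)⁻¹ ^ 52) +
        (0.0046 + 0.0014 + (2 : ℝ)⁻¹ ^ 45 + (2 : ℝ)⁻¹ ^ 53) ≤ 0.0143 := by norm_num
    linarith [hcap, hhead, hω3, hω4, hω5]
  -- §4 the resolved step
  have h := resolved_step_osc P hγ hδ₀ hd hN₀ hρN a b has h0 hb hab (K := 312500000) (by norm_num) hε (3 + 3)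
    (zoneDepth_lt_pi_half hZT (by norm_num)) (zoneDepth_lt_pi_half hZS (by norm_num)) (zoneDepth_lt_pi_half hZO (by norm_num))
    (zoneDepth_lt_pi_half hZC (by norm_num)) hαle ho
  have hjunk := resolvedJunk_le (o := o) hwT hwS hwC hwO (by norm_num) (le_refl (0.0143 : ℝ)) hfC hfS hfT hfO ho0
  have hR : (0.0097 : ℝ) ^ 2 + (0.0045 + 0.0029 + 0.0143 + (2 : ℝ)⁻¹ ^ 52) ^ 2 + (0.002 + 0.0029 + 0.0143 + (2 : ℝ)⁻¹ ^ 52) ^ 2 +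
      ((2 : ℝ)⁻¹ ^ 47) ^ 2 + ((2 : ℝ)⁻¹ ^ 44) ^ 2 + ((2 : ℝ)⁻¹ ^ 47) ^ 2 ≤ 0.000934 := by norm_num
  -- §5 the next off-cone amplitude
  have hOV := offCone_vstep_osc_le P hγ hδ₀ hd hN₀ hρN a b has h0 hb hab (K := 312500000) (by norm_num) hε (3 + 3)
    (zoneDepth_lt_pi_half hZO (by norm_num))
  have hCH := subcone_hstep_osc_le P hγ hδ₀ hd hN₀ hρN a b has h0 hb hab (K := 312500000) (by norm_num) hε (3 + 3)
    (zoneDepth_lt_pi_half hZC (by norm_num))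
  have ho' := sqrt_offCone_next_le hOV hCH hαle (hI0 _ _) (Real.sqrt_nonneg _) (Real.sqrt_nonneg _) (sq_nonneg _) (sq_nonneg _)
  have ho'' := offConeNext_le hwO hwC (le_refl (0.0143 : ℝ)) hfC hfO'
  have hRo : (0.002 : ℝ) + 0.0029 + 0.0143 + (2 : ℝ)⁻¹ ^ 52 + (2 : ℝ)⁻¹ ^ 47 ≤ 0.0193 := by norm_num
  have hlin : (0.0097 : ℝ) ^ 2 + 2 * 0.0097 * o + (0.0045 + 0.0029 + 0.0143 + (2 : ℝ)⁻¹ ^ 52) ^ 2 +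
      (0.002 + 0.0029 + 0.0143 + (2 : ℝ)⁻¹ ^ 52) ^ 2 + ((2 : ℝ)⁻¹ ^ 47) ^ 2 + ((2 : ℝ)⁻¹ ^ 44) ^ 2 + ((2 : ℝ)⁻¹ ^ 47) ^ 2 ≤
      0.000934 + 0.0194 * o := by
    linarith only [hR]
  have hfin := h.trans (add_le_add (le_refl _) (hjunk.trans hlin))
  exact ⟨hfin, (ho'.trans ho'').trans hRo⟩

end Cascade

end Summit.AnomalousDissipation.AnomalousDissipation.Theorems.SawtoothPulseCascade.K1Window
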